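import Mathlib
import Literature.Combinatorics.Kakeya.KakeyaMethodOfMultiplicities
import HarnessLib

/-!
# Kakeya sets in `𝔽_qⁿ` have at least `qⁿ / (2 − 1/q)^{n−1}` points (Bukh–Chao 2021, Theorem 1)

Topic `Literature/Combinatorics/Kakeya`.  Everything in this file is PROVED (no named fact, no
`sorry`).  Fourth file of the finite-field Kakeya lower bounds of this directory, after
`FiniteFieldKakeya.lean` (Dvir 2009: `|K| ≥ C(q + n − 1, n)`), `KakeyaMultiplicityBound.lean`
(Saraf–Sudan 2008: `|K| ≥ qⁿ / C(2n − 1, n)`) and `KakeyaMethodOfMultiplicities.lean`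
(Dvir–Kopparty–Saraf–Sudan 2013: `|K| ≥ (q/(2 − 1/q))ⁿ`): the sharp density bound, which improves
the last one by the factor `2 − 1/q` and matches the constructions of `SmallKakeyaSets.lean`
(`|K| ≤ 2^{−(n−1)} qⁿ + O(q^{n−1})`) to leading order — "closing the factor-of-two gap in all
dimensions".

B. Bukh, T.-W. Chao, *Sharp density bounds on the finite field Kakeya problem*, Discrete Analysis
2021:26, 9 pp. (doi:10.19086/da.30707; arXiv:2108.00074), verbatim:

> (Abstract) A Kakeya set in `𝔽_qⁿ` is a set containing a line in every direction. We show that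
> every Kakeya set in `𝔽_qⁿ` has density at least `1/2^{n−1}`, matching the construction by Dvir,
> Kopparty, Saraf and Sudan.
>
> (§1) **Theorem 1.** The size of every Kakeya set `K ⊆ 𝔽_qⁿ` is `|K| ≥ (2 − 1/q)^{−(n−1)} qⁿ`.
>
> (§3, "Stronger result") We call any line of the form `{a + bt : t ∈ 𝔽_q}` with
> `b = (b₁, …, b_{n−1}, 1)` non-horizontal. A set `K ⊆ 𝔽_qⁿ` is almost Kakeya if it contains a line
> in every non-horizontal direction.
> **Theorem 1′.** If `K` is an almost Kakeya set in `𝔽_qⁿ`, then `|K| ≥ qⁿ / (2 − 1/q)^{n−1}`.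
>
> **Definition 4** (Hasse derivatives). The Hasse derivatives of a polynomial
> `P(x) ∈ 𝔽_q[x₁, …, x_n]` are the polynomials `P^{(i)}(x)`, `i ∈ ℤ_{≥0}ⁿ` such that
> `P(x + y) = ∑ᵢ P^{(i)}(x) yⁱ`. […]
> **Definition 5** (Multiplicities). The multiplicity `mult(P, p)` of a polynomial `P` […] at point
> `p ∈ 𝔽_qⁿ` is the largest integer `m` such that `P^{(i)}(p) = 0` for all `i` such that `|i| < m`.
> […] Given a line `ℓ = {a + bt : t ∈ 𝔽_q}` and a polynomial `P` […], we say that `P` vanishes to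
> order `m` at the point `p = a + bt₀` along `ℓ` if the univariate polynomial `P(a + bt)` vanishes
> to order `m` at `t = t₀`. […]
> **Lemma 7** (Generalized Schwartz–Zippel lemma). If `P(x) ∈ 𝔽_q[x₁, …, x_n]` is a non-zero
> polynomial of degree `d`, then, for any set `S ⊆ 𝔽_q`, `∑_{p ∈ Sⁿ} mult(P, p) ≤ d |S|^{n−1}`.
>
> (Proof of Theorem 1′) For a non-horizontal direction `b`, there might be several lines in
> direction `b` contained in `K`. We select one such line for each `b`, and let `L` be the
> resulting set of lines. Note that `|L| = q^{n−1}`. […]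
> **Definition 8.** Let `ℓ` be a non-horizontal line, and `p ∈ ℓ`. We say that a polynomial `P`
> vanishes to order `(r, r′)` at `p` along `ℓ` if `mult_ℓ(P^{(i,0)}, p) ≥ r′ − |i|/q` for all
> `i ∈ ℤ_{≥0}^{n−1}` such that `|i| < r`.
> Let `r` be any integer divisible by `q`; eventually, we will let `r → ∞`. For any `p ∈ K` and line
> `ℓ ∈ L_p`, we set `W_{p,ℓ}` […] to be the subspace consisting of all polynomials vanishing to
> order `(r, (2 − 1/q) r)` at `p` along `ℓ`.
> **Lemma 9.** Let `p ∈ K` be arbitrary. Then the codimension of `W_p = ⋂_{ℓ ∈ L_p} W_{p,ℓ}` in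
> `𝔽_q[x₁, x₂, …, x_n]` is `codim W_p ≤ ((2 − 1/q)ⁿ + m(n − 1)(1 − 1/q)) rⁿ/n! + O_{n,q}(r^{n−1})`,
> where `m = |L_p|`.  [Proof: the conditions `W_{p,ℓ}(i, j)` — "the univariate polynomial
> `Q = P^{(i,0)}(a + bt)` satisfies `Q^{(j)}(t₀) = 0`" — are split into those with
> `|i| + j < (2 − 1/q) r`, which "involve only the coefficients `c_α` of monomials of degree
> `|α| < (2 − 1/q) r`", at most `C((2 − 1/q) r + n − 1, n)` in number, and the rest, counted line by
> line by the lattice points of `r · P`,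
> `P = {(i, j) : |i| < 1, j < (2 − 1/q) − |i|/q, |i| + j ≥ 2 − 1/q}`,
> `vol(P) = (n − 1)(1 − 1/q)/n!`.]
> Let `A = {α ∈ ℤ_{≥0}ⁿ : |α| < (2 − 1/q) r q, and α₁ + ⋯ + α_{n−1} < rq}`, and consider the vector
> space of polynomials with the monomials indexed by `A`, `V = {∑_{α ∈ A} c_α x^α : c_α ∈ 𝔽_q}`.
> **Lemma 10.** If `P ∈ V` vanishes to order `(r, (2 − 1/q) r)` at `p` along `ℓ`, for every
> `p ∈ K` and every `ℓ ∈ L_p`, then `P` is the zero polynomial.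
> […] `dim V = |A| = (1 − 1/q) rq C(rq + n − 2, n − 1) + C(rq + n − 1, n)` […] On the other hand,
> from Lemma 10 we know that `⋂_{p ∈ K} W_p ∩ V = {0}`, and hence
> `dim V ≤ codim ⋂_{p∈K} W_p ≤ ∑_{p ∈ K} codim W_p`. […] The sum above can be computed by noting
> that `∑ |L_p| = q|L| = qⁿ`. We then let `r → ∞` […] to obtain
> `n(1 − 1/q) qⁿ + qⁿ ≤ |K| (2 − 1/q)ⁿ + qⁿ (n − 1)(1 − 1/q)`. By rearranging the inequality, we see
> that this is equivalent to `|K| ≥ qⁿ / (2 − 1/q)^{n−1}`.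

## What is proved

The ambient space is `𝔽_q^{n+1} = (Fin (n + 1) → K)` and **the special coordinate is `x₀`** (the
printed text singles out the last coordinate `x_n`; this is a relabelling of the coordinates, under
which "non-horizontal" reads `b = (1, b₁, …, b_n)`, `P^{(i,0)}` reads `P^{(0,i)}` and
`P_d(x₁, …, x_{n−1}, 1)` reads `P_d(1, x₁, …, x_n)`).  Throughout `r = kq`, `k ≥ 1` (the printed
"`r` divisible by `q`"), so that `(2 − 1/q) r = (2q − 1) k` and `(2 − 1/q) r q = (2q − 1) k q` are
integers.

* `IsAlmostKakeya S` (def) — almost Kakeya sets in `𝔽ⁿ⁺¹`; `IsKakeya.isAlmostKakeya`.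
* `lowExps n N` (def, `{i ∈ ℕⁿ : |i| < N}`), `card_lowExps_eq_choose` (`= C(N + n − 1, n)`),
  `sum_degree_lowExps` (`∑_{|i|<N} |i| = n C(N + n − 1, n + 1)`); `plusPairs q n k` (def: the
  lattice points `(i, j)` of `r · P`), `card_plusPairs_mul_le`
  (`q · #plusPairs ≤ (q − 1)(n C(kq + n − 1, n + 1) + C(kq + n − 1, n))`, the count behind
  `vol(P) = (n−1)(1−1/q)/n!`); `bcExps q n k` (def: the set `A`), `le_card_bcExps` (the two sums of
  the printed computation of `dim V = |A|`).
* Univariate tools: `X_sub_C_pow_dvd_iff_taylor` (vanishing to order `m` at `t₀` through the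
  Taylor coefficients `Q^{(j)}(t₀)`, Definition 5), `eq_zero_of_forall_X_sub_C_pow_dvd`.
* `dehom H` (def: `H(1, x₁, …, x_n)`), `eval_dehom`, **`hasseDeriv_dehom`**
  (`Q^{(i)} = (P^{(0,i)})(1, ·)`), `dehom_ne_zero_of_isHomogeneous` ("`Q ≠ 0` since `P_d ≠ 0` and
  `P_d` is homogeneous").
* `lineRestrict a b` (def: `P ↦ P(a + tb)`).
* **`eq_zero_of_dvd_lineRestrict_hasseDeriv` — Lemma 10.**
* **`card_bcExps_le` — Lemma 9 together with `dim V ≤ ∑_p codim W_p`:**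
  `|A| ≤ |S| · C((2q−1)k + n, n + 1) + q^{n+1} · #plusPairs`; `bukhChao_finite_level` — the
  resulting inequality at level `r = kq` with all counts made explicit.
* `tendsto_prod_add_div_pow`, `tendsto_choose_div_pow` (`C(ak + c + m − 1, m)/k^m → a^m/m!`) — the
  limit `r → ∞`.
* **`pow_le_card_mul_pow_of_isAlmostKakeya` — Theorem 1′: `q^{2n+1} ≤ |S| · (2q − 1)ⁿ` for every
  almost Kakeya set `S ⊆ 𝔽_q^{n+1}`**, `div_pow_le_card_of_isAlmostKakeya`
  (`q^{n+1}/(2 − 1/q)ⁿ ≤ |S|`); **`pow_le_card_mul_pow_of_isKakeya`,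
  `div_pow_pred_le_card_of_isKakeya` — Theorem 1: every Kakeya set `K ⊆ 𝔽_qⁿ` has
  `q^{2n−1} ≤ |K| (2q − 1)^{n−1}`, i.e. `|K| ≥ qⁿ / (2 − 1/q)^{n−1}`** (`_ncard` versions for
  `Set`s); `pow_le_two_pow_pred_mul_card_of_isKakeya` (`qⁿ ≤ 2^{n−1} |K|`, the abstract's "density
  at least `1/2^{n−1}`").

The proof follows the printed one.  The codimension bookkeeping of Lemma 9 is realized by ONE linear
map on `V` recording, for each point `p ∈ S`, the Taylor coefficients of `P` at `p` of degree
`< (2 − 1/q) r` (these control every condition `W_{p,ℓ}(i, j)` with `|i| + j < (2 − 1/q) r`, for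
every line `ℓ` through `p`: Lemma 2.4 and Proposition 4 of the method of multiplicities, files
`KakeyaMethodOfMultiplicities.lean` / `KakeyaMultiplicityBound.lean`), and, for each incidence
(point of a chosen line, that line) and each `(i, j) ∈ plusPairs`, the functional
`P ↦ (P^{(0,i)}|_ℓ)^{(j)}(t₀)`; Lemma 10 says this map is injective, whence
`dim V ≤ |S| C((2q−1)k + n, n+1) + q^{n+1} #plusPairs` (the printed `∑_p codim W_p` with
`∑_p |L_p| = q |L| = q^{n+1}`).  The asymptotic statements `O_{n,q}(r^{n−1})` are replaced by the
exact counts above and the limit `k → ∞` of the inequality divided by `k^{n+1}`.  Hasse derivatives,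
multiplicity, Lemma 7 (for `S = 𝔽_q`: `card_mul_sum_mult_le`) and Proposition 6 are those of
`KakeyaMethodOfMultiplicities.lean` (the tree's
`Literature.AlgebraicGeometry.Resolution.hasseDeriv`).

## Not in this file

* Theorem 2 (§2: a weaker bound in `𝔽_q³` proved with vanishing to order `2` only, as an
  illustration of the monomial set `A`), superseded by Theorem 1.
* §4 (lower-order terms): Proposition 11 (Kakeya sets of size
  `2^{−n+1} qⁿ (1 + (n + 1 − 2^{−n+2})/q + O_n(q^{−2}))` for odd `q`) and the comparison with the
  constructions; see `SmallKakeyaSets.lean` for the constructions of Saraf–Sudan §3.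
* Lemma 7 for a general `S ⊆ 𝔽_q` (only `S = 𝔽_q` is used, as in the DKSS file).

## References
* [BukhChao2021SharpDensityKakeya] B. Bukh, T.-W. Chao, Discrete Analysis 2021:26 — Theorem 1 (§1),
  Theorem 1′, Definitions 4, 5, 8, Proposition 6, Lemma 7, Lemmas 9 and 10 and the proof of
  Theorem 1′ (§3), §4 (Proposition 11); quoted from arXiv:2108.00074v2, the version of record of
  this arXiv-overlay journal.
* [DvirEtAl2013] — Hasse derivatives, multiplicity, Lemma 2.4, Corollary 2.6, the multiplicity
  Schwartz–Zippel lemma (file `KakeyaMethodOfMultiplicities.lean`).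
* [SarafSudan2008KakeyaFiniteFields] — `shift`, `VanishesToOrder`, Proposition 4
  (`X_sub_C_pow_dvd_aeval_line`, file `KakeyaMultiplicityBound.lean`).
* [Dvir2009FiniteFieldKakeya] — `IsKakeya`, `coeff_aeval_line` (file `FiniteFieldKakeya.lean`).
-/


namespace Literature.Combinatorics.Kakeya

namespace FiniteFieldKakeya

open MvPolynomial Finset
open Literature.AlgebraicGeometry.Resolution (hasseDeriv)

variable {K : Type*} [Field K]

/-! ### Univariate: vanishing to order `m` at `t` through the Taylor expansion -/

/-- `(X − t)^m ∣ p` iff the Taylor expansion of `p` at `t` has no terms of degree `< m`.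
[folklore] -/
theorem X_sub_C_pow_dvd_iff_taylor (p : Polynomial K) (t : K) (m : ℕ) :
    (Polynomial.X - Polynomial.C t) ^ m ∣ p ↔
      ∀ j < m, (Polynomial.taylor t p).coeff j = 0 := by
  rw [← Polynomial.X_pow_dvd_iff]
  constructor
  · rintro ⟨r, hr⟩
    refine ⟨Polynomial.taylor t r, ?_⟩
    rw [hr, Polynomial.taylor_mul, Polynomial.taylor_pow, map_sub, Polynomial.taylor_X,
      Polynomial.taylor_C, add_sub_cancel_right]
  · rintro ⟨r, hr⟩
    refine ⟨Polynomial.taylor (-t) r, ?_⟩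
    have hp : p = Polynomial.taylor (-t) (Polynomial.taylor t p) := by
      rw [Polynomial.taylor_taylor, neg_add_cancel, Polynomial.taylor_zero]
    rw [hp, hr, Polynomial.taylor_mul, Polynomial.taylor_pow, Polynomial.taylor_X,
      Polynomial.C_neg, ← sub_eq_add_neg]

/-- A univariate polynomial over `𝔽_q` divisible by `(X − t)^m` for every `t ∈ 𝔽_q` and of degree
`< mq` is zero. [folklore] -/
theorem eq_zero_of_forall_X_sub_C_pow_dvd [Fintype K] {p : Polynomial K} {m : ℕ}
    (hdvd : ∀ t : K, (Polynomial.X - Polynomial.C t) ^ m ∣ p)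
    (hdeg : p.natDegree < m * Fintype.card K) : p = 0 := by
  classical
  by_contra hp
  have hc := Polynomial.pairwise_coprime_X_sub_C (K := K) (s := id) Function.injective_id
  have hcop : Pairwise
      (Function.onFun IsCoprime fun t : K => (Polynomial.X - Polynomial.C t) ^ m) :=
    hc.mono fun x y hxy => by exact hxy.pow
  have hprod := Finset.prod_dvd_of_coprime (hcop.set_pairwise _)
    fun t (_ : t ∈ (univ : Finset K)) => hdvd t
  have hdegprod : (∏ t ∈ (univ : Finset K), (Polynomial.X - Polynomial.C t) ^ m).natDegree =
      m * Fintype.card K := by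
    rw [Polynomial.natDegree_prod_of_monic _ _ fun t _ => (Polynomial.monic_X_sub_C t).pow m]
    simp only [Polynomial.natDegree_pow, Polynomial.natDegree_X_sub_C, mul_one, sum_const,
      card_univ, smul_eq_mul, mul_comm]
  have h1 := Polynomial.natDegree_le_of_dvd hprod hp
  rw [hdegprod] at h1
  omega

/-! ### Exponent vectors of bounded total degree -/

/-- The exponent vectors `i ∈ ℕⁿ` with `|i| < N`. [folklore] -/
noncomputable def lowExps (n N : ℕ) : Finset (Fin n →₀ ℕ) :=
  (range N).biUnion fun s => (univ : Finset (Fin n)).finsuppAntidiag s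

/-- Membership in `lowExps`. [folklore] -/
theorem mem_lowExps {n N : ℕ} {i : Fin n →₀ ℕ} : i ∈ lowExps n N ↔ i.degree < N := by
  rw [lowExps, mem_biUnion, Finsupp.degree_eq_sum]
  simp only [mem_range, mem_finsuppAntidiag, subset_univ, and_true]
  constructor
  · rintro ⟨s, hs, hsum⟩
    rw [hsum]
    exact hs
  · intro h
    exact ⟨_, h, rfl⟩

/-- The antidiagonals `{|i| = s}`, `s < N`, are pairwise disjoint. [folklore] -/
theorem pairwiseDisjoint_finsuppAntidiag (n N : ℕ) :
    ((range N : Finset ℕ) : Set ℕ).PairwiseDisjoint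
      fun s => (univ : Finset (Fin n)).finsuppAntidiag s := by
  intro s _ t _ hst
  exact Finset.disjoint_left.2 fun i hs ht => by
    rw [mem_finsuppAntidiag] at hs ht
    exact hst (hs.1.symm.trans ht.1)

/-- `#{i ∈ ℕⁿ : |i| < N} = ∑_{s < N} C(n + s − 1, s)`. [folklore] -/
theorem card_lowExps (n N : ℕ) :
    (lowExps n N).card = ∑ s ∈ range N, (n + s - 1).choose s := by
  rw [lowExps, card_biUnion (pairwiseDisjoint_finsuppAntidiag n N)]
  exact sum_congr rfl fun s _ => by
    rw [card_finsuppAntidiag_nat_eq_choose, card_univ, Fintype.card_fin]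

/-- `(a + 1) C(a + b + 1, a + 1) = (b + 1) C(a + b + 1, b + 1)` (both are `(a + b + 1)!/(a! b!)`).
[folklore] -/
theorem succ_mul_choose_symm (a b : ℕ) :
    (a + 1) * (a + b + 1).choose (a + 1) = (b + 1) * (a + b + 1).choose (b + 1) := by
  have h1 : (a + b + 1) * (a + b).choose a = (a + b + 1).choose (a + 1) * (a + 1) :=
    Nat.add_one_mul_choose_eq (a + b) a
  have h2 : (a + b + 1) * (a + b).choose b = (a + b + 1).choose (b + 1) * (b + 1) :=
    Nat.add_one_mul_choose_eq (a + b) b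
  rw [Nat.choose_symm_add] at h1
  linarith

/-- `#{i ∈ ℕⁿ : |i| < N} = C(N + n − 1, n)` (`N ≥ 1`). [folklore] -/
theorem card_lowExps_eq_choose (n : ℕ) {N : ℕ} (hN : 1 ≤ N) :
    (lowExps n N).card = (N + n - 1).choose n := by
  rw [card_lowExps]
  rcases Nat.eq_zero_or_pos n with rfl | hn
  · obtain ⟨N', rfl⟩ : ∃ N', N = N' + 1 := ⟨N - 1, by omega⟩
    rw [Finset.sum_range_succ', Finset.sum_eq_zero fun s _ => ?_]
    · simp
    · exact Nat.choose_eq_zero_of_lt (by omega)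
  · obtain ⟨m, rfl⟩ : ∃ m, n = m + 1 := ⟨n - 1, by omega⟩
    have h : ∀ s, (m + 1 + s - 1).choose s = (s + m).choose m := fun s => by
      rw [show m + 1 + s - 1 = s + m by omega, Nat.choose_symm_add]
    simp_rw [h]
    obtain ⟨N', rfl⟩ : ∃ N', N = N' + 1 := ⟨N - 1, by omega⟩
    rw [Nat.sum_range_add_choose, show N' + 1 + (m + 1) - 1 = N' + m + 1 by omega]

/-- `∑_{s < N} s C(n + s − 1, s) = n C(N + n − 1, n + 1)`. [folklore] -/
theorem sum_range_mul_choose_eq (n : ℕ) : ∀ N : ℕ,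
    ∑ s ∈ range N, s * (n + s - 1).choose s = n * (N + n - 1).choose (n + 1)
  | 0 => by simp [Nat.choose_eq_zero_of_lt (show n - 1 < n + 1 by omega)]
  | N + 1 => by
    rw [sum_range_succ, sum_range_mul_choose_eq n N]
    rcases Nat.eq_zero_or_pos n with rfl | hn
    · rcases Nat.eq_zero_or_pos N with rfl | hN
      · simp
      · simp [Nat.choose_eq_zero_of_lt (show N - 1 < N by omega)]
    obtain ⟨b, rfl⟩ : ∃ b, n = b + 1 := ⟨n - 1, by omega⟩
    rcases Nat.eq_zero_or_pos N with rfl | hN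
    · simp [Nat.choose_eq_zero_of_lt (show b < b + 1 + 1 by omega)]
    obtain ⟨a, rfl⟩ : ∃ a, N = a + 1 := ⟨N - 1, by omega⟩
    have hsymm := succ_mul_choose_symm a b
    have hpascal := Nat.choose_succ_succ (a + b + 1) (b + 1)
    rw [show a + 1 + 1 + (b + 1) - 1 = a + b + 1 + 1 by omega,
      show a + 1 + (b + 1) - 1 = a + b + 1 by omega,
      show b + 1 + (a + 1) - 1 = a + b + 1 by omega, hpascal]
    linarith

/-- `∑_{|i| < N} |i| = n C(N + n − 1, n + 1)`. [folklore] -/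
theorem sum_degree_lowExps (n N : ℕ) :
    ∑ i ∈ lowExps n N, i.degree = n * (N + n - 1).choose (n + 1) := by
  rw [lowExps, sum_biUnion (pairwiseDisjoint_finsuppAntidiag n N), ← sum_range_mul_choose_eq n N]
  refine sum_congr rfl fun s _ => ?_
  rw [sum_congr rfl fun i hi => show i.degree = s by
      rw [mem_finsuppAntidiag] at hi
      rw [Finsupp.degree_eq_sum]
      exact hi.1,
    sum_const, card_finsuppAntidiag_nat_eq_choose, card_univ, Fintype.card_fin, smul_eq_mul,
    mul_comm]


/-! ### The index set of the "high" vanishing conditions along a line -/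

/-- The pairs `(i, j)`, `i ∈ ℕⁿ`, `j ∈ ℕ`, with `|i| < kq`, `(2q − 1)k − |i| ≤ j` and
`j < (2q − 1)k − |i|/q` — the lattice points of `r · P` in the proof of Lemma 9 (`r = kq`).
[cite: BukhChao2021SharpDensityKakeya, Lemma 9 (proof: the conditions defining `W⁺_{p,ℓ}`, §3)] -/
noncomputable def plusPairs (q n k : ℕ) : Finset (Σ _ : Fin n →₀ ℕ, ℕ) :=
  (lowExps n (k * q)).sigma fun i =>
    Finset.Ico ((2 * q - 1) * k - i.degree) ((2 * q - 1) * k - i.degree / q)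

/-- Membership in `plusPairs`. [folklore] -/
theorem mem_plusPairs {q n k : ℕ} {x : Σ _ : Fin n →₀ ℕ, ℕ} :
    x ∈ plusPairs q n k ↔ x.1.degree < k * q ∧ (2 * q - 1) * k - x.1.degree ≤ x.2 ∧
      x.2 < (2 * q - 1) * k - x.1.degree / q := by
  rw [plusPairs, mem_sigma, mem_lowExps, mem_Ico]

/-- `#plusPairs = ∑_{|i| < kq} (|i| − ⌊|i|/q⌋)`. [folklore] -/
theorem card_plusPairs {q : ℕ} (n k : ℕ) (hq : 1 ≤ q) :
    (plusPairs q n k).card = ∑ i ∈ lowExps n (k * q), (i.degree - i.degree / q) := by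
  rw [plusPairs, card_sigma]
  refine sum_congr rfl fun i hi => ?_
  rw [Nat.card_Ico]
  rw [mem_lowExps] at hi
  have h1 : i.degree / q ≤ i.degree := Nat.div_le_self _ _
  have h2 : k * q ≤ (2 * q - 1) * k := by
    rw [mul_comm]
    exact Nat.mul_le_mul_right k (by omega)
  omega

/-- The count of Lemma 9: `q · #plusPairs ≤ (q − 1) (n C(kq + n − 1, n + 1) + C(kq + n − 1, n))`
(from `⌊s/q⌋ ≥ (s − q + 1)/q`; the printed volume computation gives the leading term
`(n − 1)(1 − 1/q) rⁿ/n!` in dimension `n`). [cite: BukhChao2021SharpDensityKakeya, Lemma 9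
(proof: the bound for `codim W_p⁺`, §3)] -/
theorem card_plusPairs_mul_le {q : ℕ} (n k : ℕ) (hq : 1 ≤ q) (hk : 1 ≤ k) :
    (plusPairs q n k).card * q ≤
      (q - 1) * (n * (k * q + n - 1).choose (n + 1) + (k * q + n - 1).choose n) := by
  rw [card_plusPairs n k hq, sum_mul]
  have hterm : ∀ i ∈ lowExps n (k * q),
      (i.degree - i.degree / q) * q ≤ (q - 1) * (i.degree + 1) := by
    intro i _
    set s := i.degree
    have h1 := Nat.div_add_mod s q
    have h2 := Nat.mod_lt s (by omega : 0 < q)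
    have h3 : s / q ≤ s := Nat.div_le_self _ _
    zify [h3, hq] at h1 h2 ⊢
    nlinarith
  calc ∑ i ∈ lowExps n (k * q), (i.degree - i.degree / q) * q
      ≤ ∑ i ∈ lowExps n (k * q), (q - 1) * (i.degree + 1) := sum_le_sum hterm
    _ = (q - 1) * (∑ i ∈ lowExps n (k * q), i.degree + (lowExps n (k * q)).card) := by
      rw [← mul_sum, sum_add_distrib, sum_const, smul_eq_mul, mul_one]
    _ = (q - 1) * (n * (k * q + n - 1).choose (n + 1) + (k * q + n - 1).choose n) := by
      rw [sum_degree_lowExps, card_lowExps_eq_choose n (Nat.mul_pos hk hq)]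

/-! ### The monomial set `A` and the space `V` of §3 -/

/-- The exponent set `A = {α ∈ ℕⁿ⁺¹ : |α| < (2 − 1/q) r q, α₁ + ⋯ + α_n < r q}` (here `r = kq` and
the special variable is `x₀`: `α₁ + ⋯ + α_n = |tail α|`); `V` is the span of the monomials `x^α`,
`α ∈ A`. [cite: BukhChao2021SharpDensityKakeya, §3 (definition of A and V)] -/
noncomputable def bcExps (q n k : ℕ) : Finset (Fin (n + 1) →₀ ℕ) :=
  (lowExps (n + 1) ((2 * q - 1) * k * q)).filter fun α => (Finsupp.tail α).degree < k * q * q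

/-- Membership in `bcExps`. [folklore] -/
theorem mem_bcExps {q n k : ℕ} {α : Fin (n + 1) →₀ ℕ} :
    α ∈ bcExps q n k ↔ α.degree < (2 * q - 1) * k * q ∧ (Finsupp.tail α).degree < k * q * q := by
  rw [bcExps, mem_filter, mem_lowExps]

/-- `|α| = α₀ + |tail α|`. [folklore] -/
theorem degree_eq_zero_add_degree_tail {n : ℕ} (α : Fin (n + 1) →₀ ℕ) :
    α.degree = α 0 + (Finsupp.tail α).degree := by
  rw [Finsupp.degree_eq_sum, Finsupp.degree_eq_sum, Fin.sum_univ_succ]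
  rfl

/-- **`dim V = |A| ≥ (1 − 1/q) r q C(rq + n − 1, n) + C(rq + n, n + 1)`** (the two sums of the
printed computation of `dim V = |A|`; `r = kq`, dimension `n + 1`): `A` contains the disjoint sets
`{α : α₀ < (q − 1)kq, |tail α| < kq²}` and `{α : α₀ ≥ (q − 1)kq, |α| < (2q − 1)kq}`.
[cite: BukhChao2021SharpDensityKakeya, §3 (the computation of dim V = |A|)] -/
theorem le_card_bcExps {q : ℕ} (n k : ℕ) (hq : 1 ≤ q) (hk : 1 ≤ k) :
    (q - 1) * k * q * (k * q * q + n - 1).choose n + (k * q * q + n).choose (n + 1) ≤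
      (bcExps q n k).card := by
  classical
  set c := (q - 1) * k * q with hc
  set N := k * q * q with hN
  have hN1 : 1 ≤ N := Nat.mul_pos (Nat.mul_pos hk hq) hq
  have hcN : c + N = (2 * q - 1) * k * q := by
    rw [hc, hN]
    zify [hq, (by omega : 1 ≤ 2 * q)]
    ring
  let f : ℕ × (Fin n →₀ ℕ) → (Fin (n + 1) →₀ ℕ) := fun p => Finsupp.cons p.1 p.2
  let g : (Fin (n + 1) →₀ ℕ) → (Fin (n + 1) →₀ ℕ) := fun β => β + Finsupp.single 0 c
  have hf : Function.Injective f := by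
    rintro ⟨a, i⟩ ⟨a', i'⟩ h
    have h0 := DFunLike.congr_fun h 0
    have ht := congrArg Finsupp.tail h
    simp only [f, Finsupp.cons_zero, Finsupp.tail_cons] at h0 ht
    rw [h0, ht]
  have hg : Function.Injective g := add_left_injective _
  set S1 := (range c ×ˢ lowExps n N).image f with hS1
  set S2 := (lowExps (n + 1) N).image g with hS2
  have h1 : S1.card = c * (N + n - 1).choose n := by
    rw [hS1, card_image_of_injective _ hf, card_product, card_range,
      card_lowExps_eq_choose n hN1]
  have h2 : S2.card = (N + n).choose (n + 1) := by
    rw [hS2, card_image_of_injective _ hg, card_lowExps_eq_choose (n + 1) hN1,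
      show N + (n + 1) - 1 = N + n by omega]
  have htailg : ∀ β : Fin (n + 1) →₀ ℕ, Finsupp.tail (g β) = Finsupp.tail β := by
    intro β
    ext l
    simp only [g, Finsupp.tail_apply, Finsupp.coe_add, Pi.add_apply,
      Finsupp.single_eq_of_ne (Fin.succ_ne_zero l), add_zero]
  have hdisj : Disjoint S1 S2 := by
    rw [Finset.disjoint_left]
    intro α hα1 hα2
    rw [hS1, mem_image] at hα1
    rw [hS2, mem_image] at hα2
    obtain ⟨⟨a, i⟩, hai, rfl⟩ := hα1
    obtain ⟨β, -, hβ⟩ := hα2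
    rw [mem_product, mem_range] at hai
    have h0 := DFunLike.congr_fun hβ 0
    simp only [g, f, Finsupp.coe_add, Pi.add_apply, Finsupp.single_eq_same,
      Finsupp.cons_zero] at h0
    omega
  have hsub : S1 ∪ S2 ⊆ bcExps q n k := by
    intro α hα
    rw [mem_union] at hα
    rw [mem_bcExps, ← hcN]
    rcases hα with hα | hα
    · rw [hS1, mem_image] at hα
      obtain ⟨⟨a, i⟩, hai, rfl⟩ := hα
      simp only [mem_product, mem_range, mem_lowExps] at hai
      refine ⟨?_, ?_⟩
      · show (Finsupp.cons a i : Fin (n + 1) →₀ ℕ).degree < c + N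
        rw [degree_eq_zero_add_degree_tail, Finsupp.cons_zero, Finsupp.tail_cons]
        omega
      · show (Finsupp.tail (Finsupp.cons a i : Fin (n + 1) →₀ ℕ)).degree < k * q * q
        rw [Finsupp.tail_cons]
        exact hai.2
    · rw [hS2, mem_image] at hα
      obtain ⟨β, hβ, rfl⟩ := hα
      rw [mem_lowExps] at hβ
      have hβ' := degree_eq_zero_add_degree_tail β
      refine ⟨?_, ?_⟩
      · rw [degree_eq_zero_add_degree_tail, htailg]
        simp only [g, Finsupp.coe_add, Pi.add_apply, Finsupp.single_eq_same]
        omega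
      · rw [htailg]
        omega
  calc (q - 1) * k * q * (k * q * q + n - 1).choose n + (k * q * q + n).choose (n + 1)
      = S1.card + S2.card := by rw [h1, h2]
    _ = (S1 ∪ S2).card := (card_union_of_disjoint hdisj).symm
    _ ≤ (bcExps q n k).card := card_le_card hsub

/-! ### Dehomogenization in the special variable: `H ↦ H(1, x₁, …, x_n)` -/

section Dehom

variable {n : ℕ}

/-- **Dehomogenization** `Q(x₁, …, x_n) = H(1, x₁, …, x_n)` (the polynomial
`Q = P_d(x₁, …, x_{n−1}, 1)` of the proof of Lemma 10; here the special variable is `x₀`).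
[cite: BukhChao2021SharpDensityKakeya, Lemma 10 (proof, §3)] -/
noncomputable def dehom (H : MvPolynomial (Fin (n + 1)) K) : MvPolynomial (Fin n) K :=
  aeval (Fin.cons 1 X : Fin (n + 1) → MvPolynomial (Fin n) K) H

/-- `dehom` as an `aeval`. [folklore] -/
theorem dehom_eq (H : MvPolynomial (Fin (n + 1)) K) :
    dehom H = aeval (Fin.cons 1 X : Fin (n + 1) → MvPolynomial (Fin n) K) H :=
  rfl

/-- `dehom (c x^α) = c x^{tail α}`. [folklore] -/
theorem dehom_monomial (α : Fin (n + 1) →₀ ℕ) (c : K) :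
    dehom (monomial α c) = monomial (Finsupp.tail α) c := by
  rw [dehom_eq, aeval_monomial, algebraMap_eq, Finsupp.prod_fintype _ _ (fun j => pow_zero _),
    Fin.prod_univ_succ, monomial_eq, Finsupp.prod_fintype _ _ (fun j => pow_zero _)]
  simp only [Fin.cons_zero, one_pow, one_mul, Fin.cons_succ, Finsupp.tail_apply]

/-- `(dehom H)(b') = H(1, b')`. [folklore] -/
theorem eval_dehom (b' : Fin n → K) (H : MvPolynomial (Fin (n + 1)) K) :
    eval b' (dehom H) = eval (Fin.cons 1 b') H := by
  induction H using MvPolynomial.induction_on with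
  | C c => simp [dehom_eq]
  | add p q hp hq =>
    rw [dehom_eq] at hp hq ⊢
    rw [map_add, map_add, hp, hq, map_add]
  | mul_X p k hp =>
    rw [dehom_eq] at hp ⊢
    rw [map_mul, map_mul, hp, map_mul, aeval_X, eval_X]
    congr 1
    refine Fin.cases ?_ (fun l => ?_) k
    · simp
    · simp

/-- `C(α, (0, i)) = C(tail α, i)`. [folklore] -/
theorem mchoose_cons_zero_right (α : Fin (n + 1) →₀ ℕ) (i : Fin n →₀ ℕ) :
    mchoose α (Finsupp.cons 0 i) = mchoose (Finsupp.tail α) i := by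
  rw [mchoose, mchoose, Fin.prod_univ_succ]
  simp only [Finsupp.cons_zero, Nat.choose_zero_right, one_mul, Finsupp.cons_succ,
    Finsupp.tail_apply]

/-- `tail (α − (0, i)) = tail α − i`. [folklore] -/
theorem tail_sub_cons_zero (α : Fin (n + 1) →₀ ℕ) (i : Fin n →₀ ℕ) :
    Finsupp.tail (α - Finsupp.cons 0 i) = Finsupp.tail α - i := by
  ext l
  simp only [Finsupp.tail_apply, Finsupp.coe_tsub, Pi.sub_apply, Finsupp.cons_succ]

/-- **Hasse derivatives commute with dehomogenization** ("`Q^{(i)}(b) = P^{(i,0)}(b, 1)`", proof of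
Lemma 10): `(dehom H)^{(i)} = dehom (H^{(0, i)})`. [cite: BukhChao2021SharpDensityKakeya, Lemma 10
(proof, §3)] -/
theorem hasseDeriv_dehom (i : Fin n →₀ ℕ) (H : MvPolynomial (Fin (n + 1)) K) :
    hasseDeriv K i (dehom H) = dehom (hasseDeriv K (Finsupp.cons 0 i) H) := by
  induction H using MvPolynomial.induction_on' with
  | monomial α c =>
    rw [dehom_monomial, hasseDeriv_monomial, hasseDeriv_monomial, dehom_monomial,
      tail_sub_cons_zero, mchoose_cons_zero_right]
  | add p q hp hq =>
    simp only [dehom_eq, map_add] at hp hq ⊢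
    rw [hp, hq]

/-- `dehom H` as a sum over the monomials of `H`. [folklore] -/
theorem dehom_eq_sum (H : MvPolynomial (Fin (n + 1)) K) :
    dehom H = ∑ β ∈ H.support, monomial (Finsupp.tail β) (coeff β H) := by
  conv_lhs => rw [H.as_sum, dehom_eq, map_sum]
  exact sum_congr rfl fun β _ => dehom_monomial β _

/-- The coefficients of `dehom H`. [folklore] -/
theorem coeff_dehom (H : MvPolynomial (Fin (n + 1)) K) (t : Fin n →₀ ℕ) :
    coeff t (dehom H) = ∑ β ∈ H.support with Finsupp.tail β = t, coeff β H := by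
  rw [dehom_eq_sum, coeff_sum, sum_filter]
  exact sum_congr rfl fun β _ => coeff_monomial _ _ _

/-- For `H` homogeneous, dehomogenization does not merge monomials: the coefficient of `x^{tail α}`
in `dehom H` is the coefficient of `x^α` in `H`. [folklore] -/
theorem coeff_tail_dehom_of_isHomogeneous {H : MvPolynomial (Fin (n + 1)) K} {D : ℕ}
    (hH : H.IsHomogeneous D) {α : Fin (n + 1) →₀ ℕ} (hα : α ∈ H.support) :
    coeff (Finsupp.tail α) (dehom H) = coeff α H := by
  classical
  have hdeg : ∀ β ∈ H.support, β.degree = D := fun β hβ => by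
    by_contra h
    exact (mem_support_iff.1 hβ) (hH.coeff_eq_zero h)
  rw [coeff_dehom, sum_eq_single α]
  · intro β hβ hne
    exfalso
    apply hne
    rw [mem_filter] at hβ
    have h1 := degree_eq_zero_add_degree_tail α
    have h2 := degree_eq_zero_add_degree_tail β
    rw [hdeg α hα] at h1
    rw [hdeg β hβ.1, hβ.2] at h2
    rw [← Finsupp.cons_tail α, ← Finsupp.cons_tail β, hβ.2, show β 0 = α 0 by omega]
  · intro h
    exact absurd (mem_filter.2 ⟨hα, rfl⟩ :
      α ∈ H.support.filter fun β => Finsupp.tail β = Finsupp.tail α) h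

/-- "`Q ≠ 0` since `P_d ≠ 0` and `P_d` is homogeneous" (proof of Lemma 10).
[cite: BukhChao2021SharpDensityKakeya, Lemma 10 (proof, §3)] -/
theorem dehom_ne_zero_of_isHomogeneous {H : MvPolynomial (Fin (n + 1)) K} {D : ℕ}
    (hH : H.IsHomogeneous D) (h0 : H ≠ 0) : dehom H ≠ 0 := by
  obtain ⟨α, hα⟩ := support_nonempty.2 h0
  intro h
  have hc := coeff_tail_dehom_of_isHomogeneous hH hα
  rw [h, coeff_zero] at hc
  exact (mem_support_iff.1 hα) hc.symm

/-- Every monomial of `dehom H` is the tail of a monomial of `H`. [folklore] -/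
theorem exists_tail_eq_of_mem_support_dehom {H : MvPolynomial (Fin (n + 1)) K} {t : Fin n →₀ ℕ}
    (ht : t ∈ (dehom H).support) : ∃ β ∈ H.support, Finsupp.tail β = t := by
  classical
  rw [mem_support_iff, coeff_dehom] at ht
  obtain ⟨β, hβ, -⟩ := exists_ne_zero_of_sum_ne_zero ht
  exact ⟨β, (mem_filter.1 hβ).1, (mem_filter.1 hβ).2⟩

end Dehom

/-! ### Almost Kakeya sets; the restriction to a line -/

/-- An **almost Kakeya set** (§3, "Stronger result"): `S ⊆ 𝔽ⁿ⁺¹` contains a line in every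
*non-horizontal* direction, i.e. every direction `b` with `b₀ = 1` (the printed text normalizes
the LAST coordinate, `b = (b₁, …, b_{n−1}, 1)`; here the first one — a relabelling of the
coordinates). [cite: BukhChao2021SharpDensityKakeya, §3 (definition of an almost Kakeya set)] -/
def IsAlmostKakeya {n : ℕ} (S : Set (Fin (n + 1) → K)) : Prop :=
  ∀ b' : Fin n → K, ∃ a : Fin (n + 1) → K, ∀ t : K, a + t • (Fin.cons 1 b' : Fin (n + 1) → K) ∈ S

/-- Unfolding lemma for `IsAlmostKakeya`. [folklore] -/
theorem isAlmostKakeya_iff {n : ℕ} (S : Set (Fin (n + 1) → K)) :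
    IsAlmostKakeya S ↔
      ∀ b' : Fin n → K, ∃ a : Fin (n + 1) → K, ∀ t : K,
        a + t • (Fin.cons 1 b' : Fin (n + 1) → K) ∈ S :=
  Iff.rfl

/-- A Kakeya set is almost Kakeya. [cite: BukhChao2021SharpDensityKakeya, §3] -/
theorem IsKakeya.isAlmostKakeya {n : ℕ} {S : Set (Fin (n + 1) → K)} (hS : IsKakeya S) :
    IsAlmostKakeya S :=
  fun b' => hS (Fin.cons 1 b')

/-- A superset of an almost Kakeya set is almost Kakeya. [folklore] -/
theorem IsAlmostKakeya.mono {n : ℕ} {S T : Set (Fin (n + 1) → K)} (hS : IsAlmostKakeya S)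
    (hST : S ⊆ T) : IsAlmostKakeya T :=
  fun b' => (hS b').imp fun _ ha t => hST (ha t)

/-- The restriction to the line `a + tb`: `P ↦ P(a + tb) ∈ 𝔽[t]`, as a `K`-algebra map.
[folklore] -/
noncomputable def lineRestrict {m : ℕ} (a b : Fin m → K) :
    MvPolynomial (Fin m) K →ₐ[K] Polynomial K :=
  aeval fun j => Polynomial.C (a j) + Polynomial.C (b j) * Polynomial.X

/-- Unfolding lemma for `lineRestrict`. [folklore] -/
theorem lineRestrict_apply {m : ℕ} (a b : Fin m → K) (P : MvPolynomial (Fin m) K) :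
    lineRestrict a b P =
      aeval (fun j => Polynomial.C (a j) + Polynomial.C (b j) * Polynomial.X) P :=
  rfl

/-! ### Lemma 10: a polynomial of `V` vanishing to order `(r, (2 − 1/q) r)` along the lines -/

/-- **Lemma 10.** Let `P ∈ V` (monomials in `A`, `r = kq`).  Suppose that for every non-horizontal
direction `b = (1, b')`, with its line `a(b') + t b`, and every `i ∈ ℕⁿ` with `|i| < r`, the
restriction of `P^{(0,i)}` to that line vanishes to order `(2 − 1/q) r − ⌊|i|/q⌋` at every point
(`(t − t₀)^{(2q−1)k − ⌊|i|/q⌋}` divides it for every `t₀ ∈ 𝔽_q`).  Then `P = 0`.  Proof as printed: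
the restrictions vanish identically (degree `< (2 − 1/q) r q − |i| ≤ q((2 − 1/q) r − ⌊|i|/q⌋)`),
their top coefficients `P_d^{(0,i)}(b) = 0`, so `Q = P_d(1, x')` has `mult(Q, b') ≥ r` for all
`b' ∈ 𝔽_qⁿ` and the multiplicity Schwartz–Zippel lemma forces `deg Q ≥ rq`, contradicting
`α₁ + ⋯ + α_n < rq` on `A`. [cite: BukhChao2021SharpDensityKakeya, Lemma 10 (§3)] -/
theorem eq_zero_of_dvd_lineRestrict_hasseDeriv [Fintype K] {n k : ℕ}
    {P : MvPolynomial (Fin (n + 1)) K}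
    (hP : P ∈ restrictSupport K (↑(bcExps (Fintype.card K) n k) : Set (Fin (n + 1) →₀ ℕ)))
    (a : (Fin n → K) → (Fin (n + 1) → K))
    (h : ∀ (b' : Fin n → K) (i : Fin n →₀ ℕ), i.degree < k * Fintype.card K → ∀ t₀ : K,
      (Polynomial.X - Polynomial.C t₀) ^
          ((2 * Fintype.card K - 1) * k - i.degree / Fintype.card K) ∣
        lineRestrict (a b') (Fin.cons 1 b') (hasseDeriv K (Finsupp.cons 0 i) P)) :
    P = 0 := by
  classical
  set q := Fintype.card K with hq
  have hq1 : 1 ≤ q := Fintype.card_pos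
  by_contra hP0
  have hsupp : ∀ α ∈ P.support,
      α.degree < (2 * q - 1) * k * q ∧ (Finsupp.tail α).degree < k * q * q := fun α hα =>
    mem_bcExps.1 (Finset.mem_coe.1 ((mem_restrictSupport_iff K).1 hP hα))
  set D := P.totalDegree with hD
  have hDlt : D < (2 * q - 1) * k * q := by
    obtain ⟨α, hα, hαD⟩ := Finset.exists_mem_eq_sup _ (support_nonempty.2 hP0)
      (fun s : Fin (n + 1) →₀ ℕ => s.sum fun _ e => e)
    have h1 := (hsupp α hα).1
    rw [Finsupp.degree_apply] at h1
    rw [hD, totalDegree, hαD]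
    exact h1
  set H := homogeneousComponent D P with hH
  have hH0 : H ≠ 0 := homogeneousComponent_totalDegree_ne_zero hP0
  have hHhom : H.IsHomogeneous D := homogeneousComponent_isHomogeneous D P
  -- Step 1: `P_d^{(0,i)}(1, b') = 0` for all `b'` and `|i| < kq`
  have hvan : ∀ (b' : Fin n → K) (i : Fin n →₀ ℕ), i.degree < k * q →
      eval (Fin.cons 1 b') (hasseDeriv K (Finsupp.cons 0 i) H) = 0 := by
    intro b' i hi
    set s := i.degree with hs
    have hci : (Finsupp.cons 0 i : Fin (n + 1) →₀ ℕ).degree = s := by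
      rw [degree_eq_zero_add_degree_tail, Finsupp.cons_zero, Finsupp.tail_cons, zero_add]
    by_cases hsD : D < s
    · rw [hH, hasseDeriv_homogeneousComponent_eq_zero P (by rwa [hci]), map_zero]
    push Not at hsD
    set Q := hasseDeriv K (Finsupp.cons 0 i) P with hQ
    have hQdeg : Q.totalDegree ≤ D - s := by
      have := totalDegree_hasseDeriv_le (K := K) (Finsupp.cons 0 i) P
      rwa [hci] at this
    set R := lineRestrict (a b') (Fin.cons 1 b') Q with hR
    have hRdeg : R.natDegree ≤ D - s :=
      (Extremal.natDegree_aeval_line_le (a b') (Fin.cons 1 b') Q).trans hQdeg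
    have hm : D - s < ((2 * q - 1) * k - s / q) * q := by
      have h1 : s / q * q ≤ s := Nat.div_mul_le_self s q
      have h3 : k * q ≤ (2 * q - 1) * k * q := by
        rw [mul_assoc]
        exact Nat.le_mul_of_pos_left (k * q) (by omega)
      rw [Nat.sub_mul]
      omega
    have hR0 : R = 0 :=
      eq_zero_of_forall_X_sub_C_pow_dvd (fun t₀ => h b' i hi t₀) (lt_of_le_of_lt hRdeg hm)
    have hc := coeff_aeval_line (a b') (Fin.cons 1 b') Q hQdeg
    rw [← lineRestrict_apply, ← hR, hR0, Polynomial.coeff_zero, hQ, homogeneousComponent_hasseDeriv,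
      hci, show D - s + s = D by omega] at hc
    exact hc.symm
  -- Step 2: the dehomogenization `Q = P_d(1, x')` has multiplicity `≥ kq` everywhere
  set G := dehom H with hG
  have hG0 : G ≠ 0 := dehom_ne_zero_of_isHomogeneous hHhom hH0
  have hGmult : ∀ b' : Fin n → K, k * q ≤ mult G b' := by
    intro b'
    rw [le_mult_iff hG0, vanishesToOrder_iff_hasseDeriv]
    intro i hi
    rw [hG, hasseDeriv_dehom, eval_dehom]
    exact hvan b' i hi
  -- and total degree `< kq²`
  have hGdeg : G.totalDegree < k * q * q := by
    obtain ⟨t, ht, htD⟩ := Finset.exists_mem_eq_sup _ (support_nonempty.2 hG0)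
      (fun s : Fin n →₀ ℕ => s.sum fun _ e => e)
    rw [totalDegree, htD]
    obtain ⟨β, hβ, hβt⟩ := exists_tail_eq_of_mem_support_dehom ht
    have hβP : β ∈ P.support := by
      rw [mem_support_iff, hH, coeff_homogeneousComponent] at hβ
      rw [mem_support_iff]
      intro h0
      exact hβ (by rw [h0, ite_self])
    have h2 := (hsupp β hβP).2
    rw [hβt, Finsupp.degree_apply] at h2
    exact h2
  -- Step 3: the multiplicity Schwartz–Zippel lemma
  have hSZ := card_mul_sum_mult_le G hG0
  have hsum : q ^ n * (k * q) ≤ ∑ b' : Fin n → K, mult G b' := by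
    have := Finset.sum_le_sum fun b' (_ : b' ∈ (univ : Finset (Fin n → K))) => hGmult b'
    rwa [sum_const, card_univ, Fintype.card_fun, Fintype.card_fin, smul_eq_mul] at this
  have h1 : q * (q ^ n * (k * q)) ≤ G.totalDegree * q ^ n := (Nat.mul_le_mul_left _ hsum).trans hSZ
  have hqn : 0 < q ^ n := by positivity
  have h2 : G.totalDegree * q ^ n < k * q * q * q ^ n := Nat.mul_lt_mul_of_pos_right hGdeg hqn
  have h3 : q * (q ^ n * (k * q)) = k * q * q * q ^ n := by ring
  omega

/-! ### Lemma 9 and the dimension count: `dim V ≤ ∑_p codim W_p` -/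

/-- **The dimension count of §3 (Lemma 9 + Lemma 10):** for an almost Kakeya set `S ⊆ 𝔽_qⁿ⁺¹` and
`r = kq`,
`|A| = dim V ≤ |S| · #{α ∈ ℕⁿ⁺¹ : |α| < (2 − 1/q) r} + qⁿ⁺¹ · #plusPairs`.
Mechanism (Lemma 9): at a point `p` of a chosen line `ℓ` the conditions "`P^{(0,i)}|_ℓ` vanishes
to order `j` at `p`" with `|i| + j < (2 − 1/q) r` are implied by the vanishing of the
`C((2−1/q)r + n, n+1)` Taylor coefficients of `P` at `p` of degree `< (2 − 1/q) r` (Lemma 2.4 and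
Proposition 4 of the method of multiplicities), whatever the line; the remaining conditions are the
`#plusPairs` pairs `(i, j)` per incidence `(p, ℓ)`, and there are `q · |L| = qⁿ⁺¹` incidences.  The
linear map recording all these functionals on `V` is injective by Lemma 10.
[cite: BukhChao2021SharpDensityKakeya, Lemma 9 and proof of Theorem 1′ (§3)] -/
theorem card_bcExps_le [Fintype K] {n : ℕ} {S : Finset (Fin (n + 1) → K)}
    (hS : IsAlmostKakeya (↑S : Set (Fin (n + 1) → K))) (k : ℕ) :
    (bcExps (Fintype.card K) n k).card ≤
      S.card * (lowExps (n + 1) ((2 * Fintype.card K - 1) * k)).card +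
        Fintype.card K ^ (n + 1) * (plusPairs (Fintype.card K) n k).card := by
  classical
  set q := Fintype.card K with hq
  choose a ha using (isAlmostKakeya_iff _).1 hS
  set A := bcExps q n k with hA
  set A' : Set (Fin (n + 1) →₀ ℕ) := ↑A with hA'
  set V : Submodule K (MvPolynomial (Fin (n + 1)) K) := restrictSupport K A' with hV
  set B := lowExps (n + 1) ((2 * q - 1) * k) with hB
  set T := plusPairs q n k with hT
  haveI : Module.Finite K V := Module.Finite.of_basis (basisRestrictSupport K A')
  have hdimV : Module.finrank K V = A.card := by
    rw [Module.finrank_eq_nat_card_basis (basisRestrictSupport K A'), Nat.card_coe_set_eq, hA',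
      Set.ncard_coe_finset]
  let Ψ₁ : V →ₗ[K] (↥S × ↥B → K) :=
    LinearMap.pi fun p : ↥S × ↥B =>
      (lcoeff K p.2.1).comp
        ((aeval (R := K) fun j => X j + C (p.1.1 j)).toLinearMap.comp V.subtype)
  let Ψ₂ : V →ₗ[K] ((Fin n → K) × K × ↥T → K) :=
    LinearMap.pi fun x : (Fin n → K) × K × ↥T =>
      (Polynomial.lcoeff K x.2.2.1.2).comp ((Polynomial.taylor x.2.1).comp
        ((lineRestrict (a x.1) (Fin.cons 1 x.1)).toLinearMap.comp
          ((hasseDeriv K (Finsupp.cons 0 x.2.2.1.1)).comp V.subtype)))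
  have hinj : Function.Injective (Ψ₁.prod Ψ₂) := by
    rw [← LinearMap.ker_eq_bot, LinearMap.ker_eq_bot']
    intro P hP
    have hP1 : Ψ₁ P = 0 := congrArg Prod.fst hP
    have hP2 : Ψ₂ P = 0 := congrArg Prod.snd hP
    have hΨ₁ : ∀ p : ↥S × ↥B, coeff p.2.1 (shift p.1.1 P.1) = 0 := by
      intro p
      have := congr_fun hP1 p
      simpa only [Ψ₁, LinearMap.pi_apply, LinearMap.comp_apply, Submodule.subtype_apply,
        AlgHom.toLinearMap_apply, lcoeff_apply, Pi.zero_apply, shift_eq] using this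
    have hΨ₂ : ∀ x : (Fin n → K) × K × ↥T,
        (Polynomial.taylor x.2.1 (lineRestrict (a x.1) (Fin.cons 1 x.1)
          (hasseDeriv K (Finsupp.cons 0 x.2.2.1.1) P.1))).coeff x.2.2.1.2 = 0 := by
      intro x
      have := congr_fun hP2 x
      simpa only [Ψ₂, LinearMap.pi_apply, LinearMap.comp_apply, Submodule.subtype_apply,
        AlgHom.toLinearMap_apply, Polynomial.lcoeff_apply, Pi.zero_apply] using this
    apply Subtype.ext
    refine eq_zero_of_dvd_lineRestrict_hasseDeriv P.2 a fun b' i hi t₀ => ?_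
    rw [X_sub_C_pow_dvd_iff_taylor]
    intro j hj
    by_cases hjM : (2 * q - 1) * k - i.degree ≤ j
    · have hmem : (⟨i, j⟩ : Σ _ : Fin n →₀ ℕ, ℕ) ∈ T := mem_plusPairs.2 ⟨hi, hjM, hj⟩
      exact hΨ₂ (b', t₀, ⟨⟨i, j⟩, hmem⟩)
    · push Not at hjM
      set p := a b' + t₀ • (Fin.cons 1 b' : Fin (n + 1) → K) with hp
      have hpS : p ∈ S := Finset.mem_coe.1 (ha b' t₀)
      have hvo : VanishesToOrder P.1 p ((2 * q - 1) * k) := by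
        intro s hs
        by_contra hlt
        have hsB : s ∈ B := mem_lowExps.2 (not_le.1 hlt)
        exact (mem_support_iff.1 hs) (hΨ₁ (⟨p, hpS⟩, ⟨s, hsB⟩))
      have hvo' := hvo.hasseDeriv (Finsupp.cons 0 i)
      rw [degree_eq_zero_add_degree_tail, Finsupp.cons_zero, Finsupp.tail_cons, zero_add] at hvo'
      have hdvd := X_sub_C_pow_dvd_aeval_line (a b') (Fin.cons 1 b') t₀ _ hvo'
      rw [← lineRestrict_apply, X_sub_C_pow_dvd_iff_taylor] at hdvd
      exact hdvd j hjM
  have hle := LinearMap.finrank_le_finrank_of_injective hinj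
  simp only [hdimV, Module.finrank_prod, Module.finrank_fintype_fun_eq_card, Fintype.card_prod,
    Fintype.card_coe, Fintype.card_fun, Fintype.card_fin] at hle
  calc A.card ≤ S.card * B.card + q ^ n * (q * T.card) := hle
    _ = S.card * B.card + q ^ (n + 1) * T.card := by ring

/-- **Theorem 1′ at finite level `r = kq`** (the inequality of §3 before letting `r → ∞`, cleared of
denominators): for every almost Kakeya set `S ⊆ 𝔽_qⁿ⁺¹` and every `k ≥ 1`,
`q [(q−1) k q C(kq² + n − 1, n) + C(kq² + n, n+1)] ≤`
`q |S| C((2q−1)k + n, n+1) + qⁿ⁺¹ (q − 1) (n C(kq + n − 1, n+1) + C(kq + n − 1, n))`.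
[cite: BukhChao2021SharpDensityKakeya, Theorem 1′ (proof, §3)] -/
theorem bukhChao_finite_level [Fintype K] {n : ℕ} {S : Finset (Fin (n + 1) → K)}
    (hS : IsAlmostKakeya (↑S : Set (Fin (n + 1) → K))) {k : ℕ} (hk : 1 ≤ k) :
    ((Fintype.card K - 1) * k * Fintype.card K *
          (k * Fintype.card K * Fintype.card K + n - 1).choose n +
        (k * Fintype.card K * Fintype.card K + n).choose (n + 1)) * Fintype.card K ≤
      S.card * ((2 * Fintype.card K - 1) * k + n).choose (n + 1) * Fintype.card K +
        Fintype.card K ^ (n + 1) * ((Fintype.card K - 1) *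
          (n * (k * Fintype.card K + n - 1).choose (n + 1) +
            (k * Fintype.card K + n - 1).choose n)) := by
  classical
  set q := Fintype.card K with hq
  have hq1 : 1 ≤ q := Fintype.card_pos
  have h1 := le_card_bcExps n k hq1 hk
  have h2 := card_bcExps_le hS k
  have h3 := card_plusPairs_mul_le n k hq1 hk
  have hM : 1 ≤ (2 * q - 1) * k := Nat.mul_pos (by omega) hk
  rw [card_lowExps_eq_choose (n + 1) hM, show (2 * q - 1) * k + (n + 1) - 1 = (2 * q - 1) * k + n
    by omega] at h2
  calc ((q - 1) * k * q * (k * q * q + n - 1).choose n + (k * q * q + n).choose (n + 1)) * q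
      ≤ (bcExps q n k).card * q := Nat.mul_le_mul_right _ h1
    _ ≤ (S.card * ((2 * q - 1) * k + n).choose (n + 1) +
          q ^ (n + 1) * (plusPairs q n k).card) * q := Nat.mul_le_mul_right _ h2
    _ = S.card * ((2 * q - 1) * k + n).choose (n + 1) * q +
          q ^ (n + 1) * ((plusPairs q n k).card * q) := by ring
    _ ≤ _ := Nat.add_le_add_left (Nat.mul_le_mul_left _ h3) _

/-! ### Letting `r → ∞` -/

section Limit

open Filter Topology

/-- `∏_{j<m} (a k + c + j) / k^m → a^m` as `k → ∞`. [folklore] -/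
theorem tendsto_prod_add_div_pow (a c : ℝ) (m : ℕ) :
    Tendsto (fun k : ℕ => (∏ j ∈ Finset.range m, (a * k + c + j)) / (k : ℝ) ^ m) atTop
      (𝓝 (a ^ m)) := by
  have hfac : ∀ j : ℕ, Tendsto (fun k : ℕ => a + (c + j) / k) atTop (𝓝 a) := by
    intro j
    have h0 : Tendsto (fun k : ℕ => (c + j) / (k : ℝ)) atTop (𝓝 0) :=
      tendsto_const_div_atTop_nhds_zero_nat _
    simpa using tendsto_const_nhds.add h0
  have hlim : Tendsto (fun k : ℕ => ∏ j ∈ Finset.range m, (a + (c + j) / k)) atTop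
      (𝓝 (a ^ m)) := by
    have := tendsto_finsetProd (Finset.range m) fun j (_ : j ∈ Finset.range m) => hfac j
    simpa [Finset.prod_const, Finset.card_range] using this
  refine hlim.congr' ?_
  filter_upwards [eventually_ge_atTop 1] with k hk
  have hk' : (k : ℝ) ≠ 0 := Nat.cast_ne_zero.2 (by omega)
  have hterm : ∀ j : ℕ, a + (c + j) / k = (a * k + c + j) / k := fun j => by
    field_simp
    ring
  rw [Finset.prod_congr rfl fun j _ => hterm j, Finset.prod_div_distrib, Finset.prod_const,
    Finset.card_range]

/-- `C(a k + c + m − 1, m) / k^m → a^m / m!` as `k → ∞`. [folklore] -/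
theorem tendsto_choose_div_pow (a c m : ℕ) :
    Tendsto (fun k : ℕ => ((a * k + c + m - 1).choose m : ℝ) / (k : ℝ) ^ m) atTop
      (𝓝 ((a : ℝ) ^ m / m.factorial)) := by
  have hfac : (m.factorial : ℝ) ≠ 0 := by positivity
  have h := (tendsto_prod_add_div_pow (a : ℝ) (c : ℝ) m).div_const (m.factorial : ℝ)
  refine h.congr' (Eventually.of_forall fun k => ?_)
  dsimp only
  have hprod := factorial_mul_choose_eq_prod (a * k + c) m
  push_cast at hprod
  rw [← hprod, div_div, mul_comm ((k : ℝ) ^ m), ← div_div, mul_div_cancel_left₀ _ hfac]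

/-- **Theorem 1′ (Bukh–Chao), integer form:** every almost Kakeya set `S ⊆ 𝔽_qⁿ⁺¹` satisfies
`q^{2n+1} ≤ |S| · (2q − 1)ⁿ`, i.e. `|S| ≥ qⁿ⁺¹ / (2 − 1/q)ⁿ`.  Obtained from the finite-level
inequality by dividing by `k^{n+1}` and letting `k → ∞` ("We then let `r → ∞` and compare the
resulting upper bound on `dim V` with the asymptotics in [the formula for `dim V`] to obtain
`n(1 − 1/q)qⁿ + qⁿ ≤ |K|(2 − 1/q)ⁿ + qⁿ(n − 1)(1 − 1/q)`", here in dimension `n + 1`).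
[cite: BukhChao2021SharpDensityKakeya, Theorem 1′ (§3)] -/
theorem pow_le_card_mul_pow_of_isAlmostKakeya [Fintype K] {n : ℕ} {S : Finset (Fin (n + 1) → K)}
    (hS : IsAlmostKakeya (↑S : Set (Fin (n + 1) → K))) :
    Fintype.card K ^ (2 * n + 1) ≤ S.card * (2 * Fintype.card K - 1) ^ n := by
  classical
  set q := Fintype.card K with hq
  have hq1 : 1 ≤ q := Fintype.card_pos
  have hqR : (1 : ℝ) ≤ q := by exact_mod_cast hq1
  have hqne : (q : ℝ) ≠ 0 := Nat.cast_ne_zero.2 (by omega)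
  have h2q : ((2 * q - 1 : ℕ) : ℝ) = 2 * (q : ℝ) - 1 := by
    rw [Nat.cast_sub (by omega)]
    push_cast
    ring
  have hq1' : ((q - 1 : ℕ) : ℝ) = (q : ℝ) - 1 := by
    rw [Nat.cast_sub hq1]
    push_cast
    ring
  have hnf : (n.factorial : ℝ) ≠ 0 := by positivity
  have hnf1 : ((n + 1).factorial : ℝ) ≠ 0 := by positivity
  -- the two sides of the finite-level inequality, divided by `k^{n+1}`
  set f : ℕ → ℝ := fun k =>
    ((((q - 1) * k * q * (k * q * q + n - 1).choose n + (k * q * q + n).choose (n + 1)) * q : ℕ) :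
      ℝ) / (k : ℝ) ^ (n + 1) with hf
  set g : ℕ → ℝ := fun k =>
    ((S.card * ((2 * q - 1) * k + n).choose (n + 1) * q +
        q ^ (n + 1) * ((q - 1) * (n * (k * q + n).choose (n + 1) + (k * q + n - 1).choose n)) : ℕ) :
      ℝ) / (k : ℝ) ^ (n + 1) with hg
  have hfg : ∀ᶠ k in atTop, f k ≤ g k := by
    filter_upwards [eventually_ge_atTop 1] with k hk
    have h := bukhChao_finite_level hS hk
    have hmono : (k * q + n - 1).choose (n + 1) ≤ (k * q + n).choose (n + 1) :=
      Nat.choose_le_choose _ (Nat.sub_le _ _)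
    have h' := h.trans (Nat.add_le_add_left (Nat.mul_le_mul_left _ (Nat.mul_le_mul_left _
      (Nat.add_le_add_right (Nat.mul_le_mul_left _ hmono) _))) _)
    exact div_le_div_of_nonneg_right (by exact_mod_cast h') (by positivity)
  -- limits of the pieces
  have hA : Tendsto (fun k : ℕ => (((k * q * q + n - 1).choose n : ℕ) : ℝ) / (k : ℝ) ^ n) atTop
      (𝓝 (((q * q : ℕ) : ℝ) ^ n / n.factorial)) := by
    refine (tendsto_choose_div_pow (q * q) 0 n).congr' (Eventually.of_forall fun k => ?_)
    dsimp only
    rw [add_zero, show q * q * k = k * q * q by ring]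
  have hB : Tendsto (fun k : ℕ => (((k * q * q + n).choose (n + 1) : ℕ) : ℝ) / (k : ℝ) ^ (n + 1))
      atTop (𝓝 (((q * q : ℕ) : ℝ) ^ (n + 1) / (n + 1).factorial)) := by
    refine (tendsto_choose_div_pow (q * q) 0 (n + 1)).congr' (Eventually.of_forall fun k => ?_)
    dsimp only
    rw [add_zero, show q * q * k + (n + 1) - 1 = k * q * q + n by
      rw [show q * q * k = k * q * q by ring]; omega]
  have hC : Tendsto (fun k : ℕ => ((((2 * q - 1) * k + n).choose (n + 1) : ℕ) : ℝ) /
      (k : ℝ) ^ (n + 1)) atTop (𝓝 (((2 * q - 1 : ℕ) : ℝ) ^ (n + 1) / (n + 1).factorial)) := by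
    refine (tendsto_choose_div_pow (2 * q - 1) 0 (n + 1)).congr' (Eventually.of_forall fun k => ?_)
    dsimp only
    rw [add_zero, show (2 * q - 1) * k + (n + 1) - 1 = (2 * q - 1) * k + n by omega]
  have hD : Tendsto (fun k : ℕ => (((k * q + n).choose (n + 1) : ℕ) : ℝ) / (k : ℝ) ^ (n + 1))
      atTop (𝓝 ((q : ℝ) ^ (n + 1) / (n + 1).factorial)) := by
    refine (tendsto_choose_div_pow q 0 (n + 1)).congr' (Eventually.of_forall fun k => ?_)
    dsimp only
    rw [add_zero, show q * k + (n + 1) - 1 = k * q + n by rw [mul_comm]; omega]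
  have hE : Tendsto (fun k : ℕ => (((k * q + n - 1).choose n : ℕ) : ℝ) / (k : ℝ) ^ (n + 1))
      atTop (𝓝 0) := by
    have h0 : Tendsto (fun k : ℕ => (1 : ℝ) / k) atTop (𝓝 0) :=
      tendsto_const_div_atTop_nhds_zero_nat _
    have := (tendsto_choose_div_pow q 0 n).mul h0
    rw [mul_zero] at this
    refine this.congr' (Eventually.of_forall fun k => ?_)
    dsimp only
    rw [add_zero, show q * k = k * q by ring, pow_succ, div_mul_div_comm, mul_one]
  have hfl : Tendsto f atTop (𝓝 ((((q : ℝ) - 1) * q * (((q * q : ℕ) : ℝ) ^ n / n.factorial) +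
      ((q * q : ℕ) : ℝ) ^ (n + 1) / (n + 1).factorial) * q)) := by
    have := ((hA.const_mul (((q : ℝ) - 1) * q)).add hB).mul_const (q : ℝ)
    refine this.congr' ?_
    filter_upwards [eventually_ge_atTop 1] with k hk
    have hk' : (k : ℝ) ≠ 0 := Nat.cast_ne_zero.2 (by omega)
    simp only [hf]
    push_cast [hq1']
    field_simp
    ring
  have hgl : Tendsto g atTop (𝓝 ((S.card : ℝ) * (((2 * q - 1 : ℕ) : ℝ) ^ (n + 1) /
      (n + 1).factorial) * q + (q : ℝ) ^ (n + 1) * (((q : ℝ) - 1) *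
        (n * ((q : ℝ) ^ (n + 1) / (n + 1).factorial) + 0)))) := by
    have := ((hC.const_mul (S.card : ℝ)).mul_const (q : ℝ)).add
      ((((hD.const_mul (n : ℝ)).add hE).const_mul ((q : ℝ) - 1)).const_mul ((q : ℝ) ^ (n + 1)))
    refine this.congr' ?_
    filter_upwards [eventually_ge_atTop 1] with k hk
    have hk' : (k : ℝ) ≠ 0 := Nat.cast_ne_zero.2 (by omega)
    simp only [hg]
    push_cast [hq1']
    field_simp
  have hlim := le_of_tendsto_of_tendsto hfl hgl hfg
  rw [h2q] at hlim
  -- clear denominators: multiply by `(n + 1)! / q`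
  have hfac : ((n + 1).factorial : ℝ) = (n + 1) * n.factorial := by
    rw [Nat.factorial_succ]
    push_cast
    ring
  have hc : (0 : ℝ) ≤ (n + 1) * (n.factorial : ℝ) / q := by positivity
  have h3 := mul_le_mul_of_nonneg_right hlim hc
  have e1 : (((q : ℝ) - 1) * q * (((q * q : ℕ) : ℝ) ^ n / n.factorial) +
      ((q * q : ℕ) : ℝ) ^ (n + 1) / (n + 1).factorial) * q * ((n + 1) * (n.factorial : ℝ) / q) =
      (n + 1) * ((q : ℝ) - 1) * (q : ℝ) ^ (2 * n + 1) + q * (q : ℝ) ^ (2 * n + 1) := by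
    rw [hfac]
    push_cast
    field_simp
    ring
  have e2 : ((S.card : ℝ) * ((2 * (q : ℝ) - 1) ^ (n + 1) / (n + 1).factorial) * q +
      (q : ℝ) ^ (n + 1) * (((q : ℝ) - 1) * (n * ((q : ℝ) ^ (n + 1) / (n + 1).factorial) + 0))) *
      ((n + 1) * (n.factorial : ℝ) / q) =
      (S.card : ℝ) * ((2 * (q : ℝ) - 1) * (2 * (q : ℝ) - 1) ^ n) +
        ((q : ℝ) - 1) * n * (q : ℝ) ^ (2 * n + 1) := by
    rw [hfac]
    field_simp
    ring
  rw [e1, e2] at h3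
  have h2q1 : (0 : ℝ) < 2 * (q : ℝ) - 1 := by linarith
  have key : (2 * (q : ℝ) - 1) * (q : ℝ) ^ (2 * n + 1) ≤
      (2 * (q : ℝ) - 1) * ((S.card : ℝ) * (2 * (q : ℝ) - 1) ^ n) := by
    linarith
  have hfin : (q : ℝ) ^ (2 * n + 1) ≤ (S.card : ℝ) * ((2 * q - 1 : ℕ) : ℝ) ^ n := by
    rw [h2q]
    exact le_of_mul_le_mul_left key h2q1
  exact_mod_cast hfin

/-- **Theorem 1′ (Bukh–Chao): every almost Kakeya set `S ⊆ 𝔽_qⁿ⁺¹` has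
`|S| ≥ qⁿ⁺¹ / (2 − 1/q)ⁿ`.** [cite: BukhChao2021SharpDensityKakeya, Theorem 1′ (§3)] -/
theorem div_pow_le_card_of_isAlmostKakeya [Fintype K] {n : ℕ} {S : Finset (Fin (n + 1) → K)}
    (hS : IsAlmostKakeya (↑S : Set (Fin (n + 1) → K))) :
    (Fintype.card K : ℝ) ^ (n + 1) / (2 - 1 / Fintype.card K) ^ n ≤ S.card := by
  set q := Fintype.card K with hq
  have hq1 : 1 ≤ q := Fintype.card_pos
  have hqR : (1 : ℝ) ≤ q := by exact_mod_cast hq1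
  have hqne : (q : ℝ) ≠ 0 := Nat.cast_ne_zero.2 (by omega)
  have h2q1 : (0 : ℝ) < 2 * (q : ℝ) - 1 := by linarith
  have hcast : ((2 * q - 1 : ℕ) : ℝ) = 2 * (q : ℝ) - 1 := by
    rw [Nat.cast_sub (by omega)]
    push_cast
    ring
  have h' : (q : ℝ) ^ (2 * n + 1) ≤ S.card * (2 * (q : ℝ) - 1) ^ n := by
    have := pow_le_card_mul_pow_of_isAlmostKakeya hS
    rw [← hcast]
    exact_mod_cast this
  have heq : (q : ℝ) ^ (n + 1) / (2 - 1 / (q : ℝ)) ^ n =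
      (q : ℝ) ^ (2 * n + 1) / (2 * (q : ℝ) - 1) ^ n := by
    rw [show (2 : ℝ) - 1 / q = (2 * q - 1) / q by field_simp, div_pow, div_div_eq_mul_div,
      ← pow_add, show n + 1 + n = 2 * n + 1 by ring]
  rw [heq, div_le_iff₀ (pow_pos h2q1 n)]
  exact h'

/-- Theorem 1′ for a `Set`. [cite: BukhChao2021SharpDensityKakeya, Theorem 1′ (§3)] -/
theorem pow_le_ncard_mul_pow_of_isAlmostKakeya [Fintype K] {n : ℕ} {S : Set (Fin (n + 1) → K)}
    (hS : IsAlmostKakeya S) :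
    Fintype.card K ^ (2 * n + 1) ≤ S.ncard * (2 * Fintype.card K - 1) ^ n := by
  classical
  rw [Set.ncard_eq_toFinset_card' S]
  exact pow_le_card_mul_pow_of_isAlmostKakeya (by rwa [Set.coe_toFinset])

/-- **Theorem 1 (Bukh–Chao), integer form: every Kakeya set `K ⊆ 𝔽_qⁿ` satisfies
`q^{2n−1} ≤ |K| · (2q − 1)^{n−1}`** (for `n = 0` both sides read `1 ≤ |K|`).
[cite: BukhChao2021SharpDensityKakeya, Theorem 1 (§1)] -/
theorem pow_le_card_mul_pow_of_isKakeya [Fintype K] {n : ℕ} {S : Finset (Fin n → K)}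
    (hS : IsKakeya (↑S : Set (Fin n → K))) :
    Fintype.card K ^ (2 * n - 1) ≤ S.card * (2 * Fintype.card K - 1) ^ (n - 1) := by
  cases n with
  | zero =>
    obtain ⟨x, hx⟩ := hS.nonempty
    have : 0 < S.card := Finset.card_pos.2 ⟨x, Finset.mem_coe.1 hx⟩
    simpa using this
  | succ n =>
    have h := pow_le_card_mul_pow_of_isAlmostKakeya hS.isAlmostKakeya
    rw [show 2 * (n + 1) - 1 = 2 * n + 1 by omega, Nat.add_sub_cancel]
    exact h

/-- **Theorem 1 (Bukh–Chao): every Kakeya set `K ⊆ 𝔽_qⁿ` has `|K| ≥ qⁿ / (2 − 1/q)^{n−1}`.**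
[cite: BukhChao2021SharpDensityKakeya, Theorem 1 (§1)] -/
theorem div_pow_pred_le_card_of_isKakeya [Fintype K] {n : ℕ} {S : Finset (Fin n → K)}
    (hS : IsKakeya (↑S : Set (Fin n → K))) :
    (Fintype.card K : ℝ) ^ n / (2 - 1 / Fintype.card K) ^ (n - 1) ≤ S.card := by
  cases n with
  | zero =>
    obtain ⟨x, hx⟩ := hS.nonempty
    have : 0 < S.card := Finset.card_pos.2 ⟨x, Finset.mem_coe.1 hx⟩
    have h1 : (1 : ℝ) ≤ S.card := by exact_mod_cast this
    simpa using h1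
  | succ n =>
    have h := div_pow_le_card_of_isAlmostKakeya hS.isAlmostKakeya
    rw [Nat.add_sub_cancel]
    exact h

/-- Theorem 1, the abstract's form "every Kakeya set in `𝔽_qⁿ` has density at least `1/2^{n−1}`":
`qⁿ ≤ 2^{n−1} · |K|` (from `q^{2n−1} ≤ |K| (2q − 1)^{n−1} ≤ |K| 2^{n−1} q^{n−1}`).
[cite: BukhChao2021SharpDensityKakeya, Theorem 1 (§1, Abstract)] -/
theorem pow_le_two_pow_pred_mul_card_of_isKakeya [Fintype K] {n : ℕ} {S : Finset (Fin n → K)}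
    (hS : IsKakeya (↑S : Set (Fin n → K))) :
    Fintype.card K ^ n ≤ 2 ^ (n - 1) * S.card := by
  set q := Fintype.card K with hq
  have h := pow_le_card_mul_pow_of_isKakeya hS
  have h2 : (2 * q - 1) ^ (n - 1) ≤ 2 ^ (n - 1) * q ^ (n - 1) := by
    rw [← mul_pow]
    exact Nat.pow_le_pow_left (Nat.sub_le _ _) _
  have h3 : q ^ (2 * n - 1) = q ^ n * q ^ (n - 1) := by
    rw [← pow_add]
    congr 1
    omega
  have hpos : 0 < q ^ (n - 1) := pow_pos Fintype.card_pos _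
  rw [h3] at h
  have h4 : q ^ n * q ^ (n - 1) ≤ 2 ^ (n - 1) * S.card * q ^ (n - 1) :=
    calc q ^ n * q ^ (n - 1) ≤ S.card * (2 * q - 1) ^ (n - 1) := h
      _ ≤ S.card * (2 ^ (n - 1) * q ^ (n - 1)) := Nat.mul_le_mul_left _ h2
      _ = 2 ^ (n - 1) * S.card * q ^ (n - 1) := by ring
  exact Nat.le_of_mul_le_mul_right h4 hpos

/-- Theorem 1 for a `Set`: `q^{2n−1} ≤ |K| (2q − 1)^{n−1}`. [cite: BukhChao2021SharpDensityKakeya,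
Theorem 1 (§1)] -/
theorem pow_le_ncard_mul_pow_of_isKakeya [Fintype K] {n : ℕ} {S : Set (Fin n → K)}
    (hS : IsKakeya S) :
    Fintype.card K ^ (2 * n - 1) ≤ S.ncard * (2 * Fintype.card K - 1) ^ (n - 1) := by
  classical
  rw [Set.ncard_eq_toFinset_card' S]
  exact pow_le_card_mul_pow_of_isKakeya (by rwa [Set.coe_toFinset])

/-- Theorem 1 for a `Set`, density form: `qⁿ ≤ 2^{n−1} · |K|`.
[cite: BukhChao2021SharpDensityKakeya, Theorem 1 (§1, Abstract)] -/
theorem pow_le_two_pow_pred_mul_ncard_of_isKakeya [Fintype K] {n : ℕ} {S : Set (Fin n → K)}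
    (hS : IsKakeya S) : Fintype.card K ^ n ≤ 2 ^ (n - 1) * S.ncard := by
  classical
  rw [Set.ncard_eq_toFinset_card' S]
  exact pow_le_two_pow_pred_mul_card_of_isKakeya (by rwa [Set.coe_toFinset])

end Limit

end FiniteFieldKakeya

end Literature.Combinatorics.Kakeya
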